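import Summits.CriticalPhenomena.PercolationContinuityZ3.Theorems.PercNearOneGluingNoHeavyLowerTailCSHPeel
import HarnessLib

/-!
# `NoHeavyLowerTail` (stmt-CriticalPhenomena-4575) — memo Theorem 2 (the CSH peel) WITH A RELATIVE CSH TOLERANCE:
# `−2ε·|T| ≤ s5dMargin` on `[0,1]`-valued functionals

Support file (`--supports stmt-CriticalPhenomena-4575`), effectivity-audit lane `prim-rate`, seat audit-1 (block (A) = the conditioned
slack hierarchy CSH and the (S5) peeling).  Deliverable (b) material («what an APPROXIMATE substitute for the exact finite-graph engine
would cost downstream», HOME/SUBSTITUTES.md §TOL — the link INSIDE block (A): CSH level ⟶ the decoy-free (S5D) margin, i.e. the input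
of `CSH.Defect.*` in `…AdditiveGluingDefectStabilitySocket01.lean`).  Nothing here is used by the tree's proof of `NoHeavyLowerTail` /
`AdditiveGluing` (the zero-tolerance case `CSH.s5dMargin_nonneg_of_csh`, `…CSHPeel.lean:44–201`).  No definitions, no named facts, no
sorries; standard axioms.

THE STATEMENT (`CSH.Defect.s5dMargin_ge_of_csh_relDefect`).  Non-degenerate weights `w` on the pairs of `Fin n`, observers `o, v`,
`ε ≥ 0`.  HYPOTHESIS (CSH up to a RELATIVE tolerance ε on normalised functionals): for every admissible owner / avoided set / decoy
list `(x, Y, D)` and every MONOTONE functional `f` of the open edge cluster of `x` WITH VALUES IN `[0,1]`,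
  `cshMargin w x Y D o v f ≥ −ε · μ(x ↮ Y) · ∫_{x ↮ Y} (1 − f(C_x)) dμ`;
the right-hand side is `ε ×` an a-priori bound of every entry `covD(f, u) = μ(x↮Y)²·Cov(f(C_x), 1{x↔u} | x↮Y)` of the margin
(`|Cov(f, g)| ≤ E|1 − f|` for `f, g ∈ [0,1]`), so the hypothesis reads «relative error at most ε in the natural scale of the
conditional covariances»; at `f = Ψ_iso` it is `ε·μ(x↮Y, C_x = ∅)·μ(x↮Y)`, i.e. `ε ×` the exact coefficient of `covD(Ψ_iso)`
(`CSH.covD_psiIso`).  CONCLUSION: for every relay set `T`, injective `m`-compatible rank `r`, decoy list `D` and monotone `F` with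
values in `[0,1]`:  `−2ε·|T| ≤ s5dMargin w T r D o v F` — per peeled relay the two CSH instances the peel consumes (`F̂_k` and `Ψ_iso`,
both `[0,1]`-valued) cost at most `ε` each after the divisions by `μ(D_k)` (cancellation of the conditioning) and by
`μ(D_k, C_k = ∅)·μ(D_k)` (Lemma AC), the weight `Sur_k − κ_k` of the second lying in `[0,1]` (Lemma κ and `F ≤ 1`); the induction
hypothesis enters with coefficient exactly 1, so the losses ADD over the `|T|` levels (the depth factor of block (A)).  The proof is
the tree's with these two bookkeeping lines threaded through.

WHY THE BINDER IS RESTRICTED TO `[0,1]`-VALUED `f` (audit-1 gen 12, precision (bb); audit-2 gen 16): `cshMargin` is linear in `f`, so a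
tolerance asked for ALL monotone `f` at a scale not tied to `f` is exact CSH in disguise (apply it to `c • f`, `c → ∞`); with the binder
restricted to a scale-fixed class the hypothesis is genuinely weaker than CSH and the conclusion genuinely weaker than (S5D) — these are
the tolerance-BEARING statements.  The general closed-form version (arbitrary tolerance profile `η(x, Y, f)`, accumulated loss
`Σ_k [η(k,T_<k,F̂_k)/M_k + (Sur_k − κ_k)·η(k,T_<k,Ψ_iso)/(I_k M_k)]`) is the lane's scratch certificate
(prim-rate-audit-2/probe/DefectStabilityG16b.lean, rc 0, 2026-08-22); this file keeps the one profile a substitute-builder needs.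
[cite: VandenbergHaggstromKahn2005, Thm. 1.3 (p. 6)] [cite: KozmaNitzan2024, Conj. 1 (p. 3), Conj. 4 (p. 32)]
-/

noncomputable section

namespace Summit.CriticalPhenomena.PercolationContinuityZ3.Theorems

open MeasureTheory Set Literature.Probability.LatticeModels Literature.Probability.Percolation
open scoped Classical
open KNPreFKG

namespace CSH.Defect

variable {n : ℕ}

/-- **Memo Theorem 2 with a relative CSH tolerance.**  If, at non-degenerate weights, the conditioned slack hierarchy holds up to
`−ε·μ(x↮Y)·∫_{x↮Y}(1 − f(C_x))` for every admissible `(x, Y, D)` and every `[0,1]`-valued monotone functional `f` of the open edge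
cluster of `x`, then `−2ε·|T| ≤ s5dMargin w T r D o v F` for every relay set `T`, injective `m`-compatible rank, decoy list `D` and
`[0,1]`-valued monotone `F` — the tree proof of `CSH.s5dMargin_nonneg_of_csh` (`…CSHPeel.lean:44–201`) with the tolerance threaded
through: `ε` per CSH instance per peeled relay, coefficient 1 on the induction hypothesis.
(lane prim-rate effectivity audit, deliverable (b); audit-1 gen 52, after audit-2 gens 15/16 and audit-1 gen 12)
[cite: KozmaNitzan2024, Conj. 4 (p. 32)] -/
theorem s5dMargin_ge_of_csh_relDefect (w : Sym2 (Fin n) → unitInterval) (hw : ∀ e, 0 < w e ∧ w e < 1) (o v : Fin n)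
    (ε : ℝ) (hε : 0 ≤ ε)
    (hCSHε : ∀ (x : Fin n) (Y : Finset (Fin n)) (D : List (Fin n)),
      x ∉ Y → o ≠ x → v ≠ x → o ∉ Y → v ∉ Y → D.Nodup → (∀ d ∈ D, d ≠ x ∧ d ∉ Y ∧ d ≠ o ∧ d ≠ v) →
      ∀ f : Set (Sym2 (Fin n)) → ℝ, Monotone f → (∀ C, 0 ≤ f C) → (∀ C, f C ≤ 1) →
        -(ε * ((prodBernoulli w).real {ω : BondConfig (Fin n) | ∀ y ∈ (↑Y : Set (Fin n)), ¬ (openGraph ω).Reachable x y} *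
            ∫ ω in {ω : BondConfig (Fin n) | ∀ y ∈ (↑Y : Set (Fin n)), ¬ (openGraph ω).Reachable x y},
              (1 - f (openEdgeCluster ω x)) ∂(prodBernoulli w))) ≤
          cshMargin w x (↑Y : Set (Fin n)) D o v f) :
    ∀ (T : Finset (Fin n)) (r : Fin n → ℕ) (D : List (Fin n)) (F : Set (Fin n) → ℝ),
      (∀ S S' : Set (Fin n), S ⊆ S' → F S ≤ F S') → (∀ S, 0 ≤ F S) → (∀ S, F S ≤ 1) → Set.InjOn r ↑T →
      (∀ a ∈ T, ∀ a' ∈ T, r a < r a' →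
        ∫ ω, F (openCluster ω a) ∂(prodBernoulli w) ≤ ∫ ω, F (openCluster ω a') ∂(prodBernoulli w)) →
      o ∉ T → v ∉ T → D.Nodup → (∀ d ∈ D, d ∉ T ∧ d ≠ o ∧ d ≠ v) →
      -(2 * ε * T.card) ≤ s5dMargin w T r D o v F := by
  classical
  -- strong induction on `|T|`
  have main : ∀ (N : ℕ) (T : Finset (Fin n)) (r : Fin n → ℕ) (D : List (Fin n)) (F : Set (Fin n) → ℝ), T.card = N →
      (∀ S S' : Set (Fin n), S ⊆ S' → F S ≤ F S') → (∀ S, 0 ≤ F S) → (∀ S, F S ≤ 1) → Set.InjOn r ↑T →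
      (∀ a ∈ T, ∀ a' ∈ T, r a < r a' →
        ∫ ω, F (openCluster ω a) ∂(prodBernoulli w) ≤ ∫ ω, F (openCluster ω a') ∂(prodBernoulli w)) →
      o ∉ T → v ∉ T → D.Nodup → (∀ d ∈ D, d ∉ T ∧ d ≠ o ∧ d ≠ v) →
      -(2 * ε * T.card) ≤ s5dMargin w T r D o v F := by
    intro N
    induction N using Nat.strong_induction_on with
    | _ N ih =>
    intro T r D F hN hF hF0 hF1 hr hcompat hoT hvT hD hDT
    set μ := prodBernoulli w with hμ
    have hmeas : ∀ S : Set (BondConfig (Fin n)), MeasurableSet S := fun _ => MeasurableSet.of_discrete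
    have hn := fun (S : Set (BondConfig (Fin n))) => (measureReal_nonneg : 0 ≤ μ.real S)
    have hle1 : ∀ S : Set (BondConfig (Fin n)), μ.real S ≤ 1 := fun S =>
      (measureReal_mono (subset_univ S) (measure_ne_top _ _)).trans (le_of_eq probReal_univ)
    rcases T.eq_empty_or_nonempty with hT0 | hne
    · -- no relays: the surplus vanishes identically, and there is no loss
      subst hT0
      have h0 : surplus w (∅ : Finset (Fin n)) r F = fun _ => 0 := by
        funext u; simp [surplus]
      have h00 : s5dMargin w (∅ : Finset (Fin n)) r D o v F = 0 := by
        rw [s5dMargin, h0]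
        have := slForm_zero (decoyList w (↑(∅ : Finset (Fin n)) : Set (Fin n)) D)
        simp only [cshMarg]
        rw [show (fun _ : Fin n => (0 : ℝ)) = (0 : Fin n → ℝ) from rfl, this]
        simp
      rw [h00, Finset.card_empty, Nat.cast_zero, mul_zero, neg_zero]
    -- the rank-maximal relay `k` and `T' = T.erase k`
    obtain ⟨k, hkT, hkmax⟩ := Finset.exists_max_image T r hne
    set T' : Finset (Fin n) := T.erase k with hT'
    have hTcard : T'.card < N := by
      have hpos : 0 < T.card := Finset.card_pos.2 hne
      rw [hT', Finset.card_erase_of_mem hkT]; omega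
    have hT'T : ∀ a ∈ T', a ∈ T := fun a ha => Finset.mem_of_mem_erase ha
    have hkT' : k ∉ T' := Finset.notMem_erase k T
    have hlt : ∀ a ∈ T', r a < r k := by
      intro a ha
      rcases (hkmax a (hT'T a ha)).lt_or_eq with h | h
      · exact h
      · exact absurd (hr (hT'T a ha) hkT h) (Finset.ne_of_mem_erase ha)
    have hrT' : Set.InjOn r ↑T' := hr.mono (by intro a ha; exact hT'T a ha)
    have hcompatT' : ∀ a ∈ T', ∀ a' ∈ T', r a < r a' →
        ∫ ω, F (openCluster ω a) ∂μ ≤ ∫ ω, F (openCluster ω a') ∂μ :=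
      fun a ha a' ha' h => hcompat a (hT'T a ha) a' (hT'T a' ha') h
    have hmle : ∀ a ∈ T', ∫ ω, F (openCluster ω a) ∂μ ≤ ∫ ω, F (openCluster ω k) ∂μ :=
      fun a ha => hcompat a (hT'T a ha) k hkT (hlt a ha)
    have hko : o ≠ k := fun h => hoT (h ▸ hkT)
    have hkv : v ≠ k := fun h => hvT (h ▸ hkT)
    have hkD : k ∉ D := fun h => (hDT k h).1 hkT
    -- the objects
    set Dk : Set (BondConfig (Fin n)) := {ω : BondConfig (Fin n) | ∀ a ∈ (↑T' : Set (Fin n)), ¬ (openGraph ω).Reachable k a}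
      with hDk
    set mk : ℝ := ∫ ω, F (openCluster ω k) ∂μ with hmk
    set κ : ℝ := mk * μ.real Dk - ∫ ω in Dk, F (openCluster ω k) ∂μ with hκ
    set L := decoyList w (↑T : Set (Fin n)) D with hL
    set p : ℝ := obsConst w o v ((↑T : Set (Fin n)) ∪ {d | d ∈ D}) with hp
    set ck : Fin n → ℝ := avoidConst w k (↑T' : Set (Fin n)) with hck
    set Fh : Set (Sym2 (Fin n)) → ℝ := fun C => F {a | a = k ∨ ∃ e ∈ C, a ∈ e} with hFh
    set Tk : Fin n → ℝ := fun u => (∫ ω in Dk ∩ openConn k u, F (openCluster ω k) ∂μ) - μ.real (Dk ∩ openConn k u) * mk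
      with hTk
    -- the two functionals the peel consumes are `[0,1]`-valued
    have hFh0 : ∀ C, 0 ≤ Fh C := fun C => hF0 _
    have hFh1 : ∀ C, Fh C ≤ 1 := fun C => hF1 _
    have hψ1 : ∀ C : Set (Sym2 (Fin n)), psiIso C ≤ 1 := fun C => by unfold psiIso; split_ifs <;> norm_num
    -- positivity of the conditioning events (non-degenerate weights)
    have hempty_Dk : (∅ : BondConfig (Fin n)) ∈ Dk := by
      intro a ha h
      rw [HullPort.reachable_empty_iff] at h
      exact hkT' (h ▸ (Finset.mem_coe.1 ha))
    have hDkpos : 0 < μ.real Dk := prodBernoulli_real_pos_of_nonempty hw ⟨∅, hempty_Dk⟩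
    have hisopos : 0 < μ.real (Dk ∩ {ω | openEdgeCluster ω k = ∅}) :=
      prodBernoulli_real_pos_of_nonempty hw ⟨∅, hempty_Dk, subset_empty_iff.1 (openEdgeCluster_subset ∅ k)⟩
    have hIM : 0 < μ.real (Dk ∩ {ω | openEdgeCluster ω k = ∅}) * μ.real Dk := mul_pos hisopos hDkpos
    -- set identities between the systems `(T; D)`, `(T'; k; D)` and `(T'; k :: D)`
    have hins : insert k (↑T' : Set (Fin n)) = ↑T := by
      rw [hT', Finset.coe_erase, insert_sdiff_singleton, insert_eq_of_mem (Finset.mem_coe.2 hkT)]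
    have hset2 : (↑T' : Set (Fin n)) ∪ {d | d ∈ k :: D} = (↑T : Set (Fin n)) ∪ {d | d ∈ D} := by
      ext a
      simp only [mem_union, Finset.mem_coe, hT', Finset.mem_erase, mem_setOf_eq, List.mem_cons]
      constructor
      · rintro (⟨_, ha⟩ | rfl | ha)
        · exact Or.inl ha
        · exact Or.inl hkT
        · exact Or.inr ha
      · rintro (ha | ha)
        · by_cases hak : a = k
          · exact Or.inr (Or.inl hak)
          · exact Or.inl ⟨hak, ha⟩
        · exact Or.inr (Or.inr ha)
    have hcshMargin : ∀ f : Set (Sym2 (Fin n)) → ℝ,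
        cshMargin w k (↑T' : Set (Fin n)) D o v f = cshMarg L p o v (covD w k (↑T' : Set (Fin n)) f) := by
      intro f
      rw [cshMargin, hins]
    have hnext : s5dMargin w T' r (k :: D) o v F =
        cshMarg L p o v (surplus w T' r F) - surplus w T' r F k * cshMarg L p o v ck := by
      rw [s5dMargin, hset2, decoyList, hins, cshMarg_cons]
    -- (1) Lemma P: peel `k`
    have hpeel : surplus w T r F = (surplus w T' r F) + Tk := by
      funext u
      rw [Pi.add_apply, surplus_erase_add w T r F hkT hlt u]
    -- (2) the top-relay term through `covD`
    have hTk_cov : (μ.real Dk) • Tk = covD w k (↑T' : Set (Fin n)) Fh - (κ * μ.real Dk) • ck := by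
      funext u
      simp only [Pi.smul_apply, Pi.sub_apply, smul_eq_mul]
      have h1 := covD_clusterFun_eq w T' F k u
      have h2 : μ.real (Dk ∩ openConn k u) = μ.real Dk * ck u := by
        simp only [hck, avoidConst, hDk]
        rw [mul_div_cancel₀ _ (ne_of_gt hDkpos)]
      simp only [hTk, hFh, hκ, hmk, hDk] at h1 h2 ⊢
      rw [h1, h2]
      ring
    -- (3) CSH with tolerance for the peeled relay, functional `F̂`: the loss is at most `ε·μ(Dk)`
    have hCSHk := hCSHε k T' D hkT' hko hkv (fun h => hoT (hT'T o h)) (fun h => hvT (hT'T v h)) hD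
      (fun d hd => ⟨fun h => hkD (h ▸ hd), fun h => (hDT d hd).1 (hT'T d h), (hDT d hd).2.1, (hDT d hd).2.2⟩)
    have h3 : -(ε * (μ.real Dk * ∫ ω in Dk, (1 - Fh (openEdgeCluster ω k)) ∂μ)) ≤
        cshMarg L p o v (covD w k (↑T' : Set (Fin n)) Fh) := by
      rw [← hcshMargin]
      exact hCSHk Fh (monotone_clusterFun k F hF) hFh0 hFh1
    have hint1 : ∫ ω in Dk, (1 - Fh (openEdgeCluster ω k)) ∂μ ≤ 1 := by
      have hle : ∫ ω in Dk, (1 - Fh (openEdgeCluster ω k)) ∂μ ≤ ∫ ω in Dk, (1 : ℝ) ∂μ :=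
        setIntegral_mono_on (Integrable.of_finite (μ := μ) (f := fun ω => 1 - Fh (openEdgeCluster ω k))).integrableOn
          (Integrable.of_finite (μ := μ) (f := fun _ => (1 : ℝ))).integrableOn (hmeas Dk)
          (fun ω _ => by linarith [hFh0 (openEdgeCluster ω k)])
      rw [setIntegral_const, smul_eq_mul, mul_one] at hle
      exact hle.trans (hle1 Dk)
    have hA : -(ε * μ.real Dk) ≤ cshMarg L p o v (covD w k (↑T' : Set (Fin n)) Fh) := by
      have h := mul_le_mul_of_nonneg_left (mul_le_mul_of_nonneg_left hint1 hDkpos.le) hε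
      rw [mul_one] at h
      linarith [h3, h]
    -- (4) Lemma AC with tolerance: `Marg[c_k] ≥ -ε` from the toleranced CSH applied to `Ψ_iso`, whose loss
    -- `ε·μ(Dk)·∫_{Dk}(1 − Ψ_iso(C_k)) = ε·μ(Dk)·μ(Dk, C_k = ∅)` is `ε ×` the coefficient `μ(Dk, C_k = ∅)·μ(Dk)` of `covD(Ψ_iso)`
    have hψint : ∫ ω in Dk, (1 - psiIso (openEdgeCluster ω k)) ∂μ = μ.real (Dk ∩ {ω | openEdgeCluster ω k = ∅}) := by
      have hsplit := (integral_inter_add_sdiff (hmeas {ω : BondConfig (Fin n) | openEdgeCluster ω k = ∅})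
        ((Integrable.of_finite (f := fun ω => 1 - psiIso (openEdgeCluster ω k)) (μ := μ)).integrableOn (s := Dk))).symm
      rw [hsplit]
      have ha : ∫ ω in Dk ∩ {ω | openEdgeCluster ω k = ∅}, (1 - psiIso (openEdgeCluster ω k)) ∂μ =
          μ.real (Dk ∩ {ω | openEdgeCluster ω k = ∅}) := by
        rw [setIntegral_congr_fun (hmeas _) (fun ω hω => by
          show (1 : ℝ) - psiIso (openEdgeCluster ω k) = 1
          have hC : openEdgeCluster ω k = ∅ := hω.2
          simp [psiIso, hC]), setIntegral_const, smul_eq_mul, mul_one]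
      have hb : ∫ ω in Dk \ {ω | openEdgeCluster ω k = ∅}, (1 - psiIso (openEdgeCluster ω k)) ∂μ = 0 := by
        rw [setIntegral_congr_fun (hmeas _) (fun ω hω => by
          show (1 : ℝ) - psiIso (openEdgeCluster ω k) = 0
          have hC : openEdgeCluster ω k ≠ ∅ := hω.2
          simp [psiIso, hC]), setIntegral_const, smul_eq_mul, mul_zero]
      rw [ha, hb, add_zero]
    have h4 : -ε ≤ cshMarg L p o v ck := by
      have hiso : -(ε * (μ.real Dk * ∫ ω in Dk, (1 - psiIso (openEdgeCluster ω k)) ∂μ)) ≤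
          cshMargin w k (↑T' : Set (Fin n)) D o v psiIso := hCSHk psiIso psiIso_mono psiIso_nonneg hψ1
      rw [hψint, hcshMargin] at hiso
      have hLk : ∀ dc ∈ L, dc.1 ≠ k := fun dc hdc h => hkD (h ▸ mem_decoyList w _ D dc hdc)
      rw [cshMarg_congr L p o v (covD w k (↑T' : Set (Fin n)) psiIso)
        ((μ.real (Dk ∩ {ω | openEdgeCluster ω k = ∅}) * μ.real Dk) • ck) (fun u => u ≠ k) hLk hko hkv
        (fun u hu => by
          rw [covD_psiIso w T' k u hu, Pi.smul_apply, smul_eq_mul]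
          simp only [hck, avoidConst, hDk]
          rw [mul_assoc, mul_div_cancel₀ _ (ne_of_gt hDkpos)]), cshMarg_smul] at hiso
      have e : μ.real (Dk ∩ {ω | openEdgeCluster ω k = ∅}) * μ.real Dk * (-ε) =
          -(ε * (μ.real Dk * μ.real (Dk ∩ {ω | openEdgeCluster ω k = ∅}))) := by ring
      exact le_of_mul_le_mul_left (by rw [e]; exact hiso) hIM
    -- (5) Lemma κ, and the weight `Sur_k(T') − κ_k ≤ 1` for `[0,1]`-valued `F`
    have h5 : κ ≤ surplus w T' r F k := kappa_le_surplus w T' r F k hrT' hmle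
    have hS1 : surplus w T' r F k - κ ≤ 1 := by
      set Wk : Set (BondConfig (Fin n)) := ⋃ a ∈ T', openConn k a with hWk
      have hDW : Dk = Wkᶜ := by
        ext ω
        simp [hDk, hWk, openConn]
      have hDint : ∫ ω in Dk, F (openCluster ω k) ∂μ = mk - ∫ ω in Wk, F (openCluster ω k) ∂μ := by
        have := integral_add_compl (hmeas Wk) (Integrable.of_finite (f := fun ω => F (openCluster ω k)) (μ := μ))
        rw [← hDW] at this
        rw [hmk]
        linarith
      have hDμ : μ.real Dk = 1 - μ.real Wk := by
        have h1 : μ.real (univ : Set (BondConfig (Fin n))) = μ.real (univ ∩ Wk) + μ.real (univ \ Wk) :=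
          (measureReal_inter_add_sdiff (s := univ) (h := measure_ne_top _ _) (hmeas Wk)).symm
        rw [probReal_univ, univ_inter, ← compl_eq_univ_sdiff, ← hDW] at h1
        linarith
      have hsum : 0 ≤ ∑ a ∈ T', μ.real
          (openConn k a ∩ ⋂ a' ∈ T'.filter (fun a' => r a' < r a), (openConn k a')ᶜ : Set (BondConfig (Fin n))) *
            ∫ ω, F (openCluster ω a) ∂μ :=
        Finset.sum_nonneg fun a _ => mul_nonneg (hn _) (integral_nonneg fun ω => hF0 _)
      have hmk1 : mk ≤ 1 := by
        have h := integral_mono (μ := μ) (Integrable.of_finite (f := fun ω => F (openCluster ω k)))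
          (integrable_const (1 : ℝ)) (fun ω => hF1 (openCluster ω k))
        simpa [integral_const, probReal_univ] using h
      have hmk0 : 0 ≤ mk := integral_nonneg fun ω => hF0 _
      have hprod : mk * μ.real Wk ≤ 1 := by
        calc mk * μ.real Wk ≤ 1 * 1 := mul_le_mul hmk1 (hle1 Wk) (hn _) zero_le_one
          _ = 1 := one_mul 1
      unfold surplus
      rw [hκ, hDint, hDμ]
      change (∫ ω in Wk, F (openCluster ω k) ∂μ) - _ - (mk * (1 - μ.real Wk) - (mk - ∫ ω in Wk, F (openCluster ω k) ∂μ)) ≤ 1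
      linarith [hprod, hsum]
    -- (6) the next rung by induction (with its accumulated loss `2ε·|T'|`)
    have h6 : -(2 * ε * T'.card) ≤ s5dMargin w T' r (k :: D) o v F :=
      ih T'.card hTcard T' r (k :: D) F rfl hF hF0 hF1 hrT' hcompatT' (fun h => hoT (hT'T o h)) (fun h => hvT (hT'T v h))
        (List.nodup_cons.2 ⟨hkD, hD⟩)
        (fun d hd => by
          rcases List.mem_cons.1 hd with rfl | hd
          · exact ⟨hkT', hko.symm, hkv.symm⟩
          · exact ⟨fun h => (hDT d hd).1 (hT'T d h), (hDT d hd).2.1, (hDT d hd).2.2⟩)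
    -- (7) assemble: `μ(Dk)·s5dMargin(T; D) ≥ μ(Dk)·s5dMargin(T'; k :: D) − ε·μ(Dk) − ε·μ(Dk)`
    have hmain : μ.real Dk * s5dMargin w T r D o v F =
        μ.real Dk * cshMarg L p o v (surplus w T' r F) + cshMarg L p o v (covD w k (↑T' : Set (Fin n)) Fh) -
          κ * μ.real Dk * cshMarg L p o v ck := by
      have e1 : μ.real Dk * cshMarg L p o v Tk =
          cshMarg L p o v (covD w k (↑T' : Set (Fin n)) Fh) - κ * μ.real Dk * cshMarg L p o v ck := by
        rw [← cshMarg_smul, hTk_cov, cshMarg_sub, cshMarg_smul]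
      rw [s5dMargin, ← hL, ← hp, hpeel, cshMarg_add, mul_add, e1]
      ring
    have hB : μ.real Dk * (-ε) ≤ μ.real Dk * ((surplus w T' r F k - κ) * cshMarg L p o v ck) := by
      refine mul_le_mul_of_nonneg_left ?_ hDkpos.le
      have hsk0 : 0 ≤ surplus w T' r F k - κ := sub_nonneg.2 h5
      have i1 := mul_le_mul_of_nonneg_left h4 hsk0
      have i2 := mul_le_mul_of_nonneg_left hS1 hε
      linarith [i1, i2]
    have hstep : μ.real Dk * s5dMargin w T' r (k :: D) o v F - ε * μ.real Dk - ε * μ.real Dk ≤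
        μ.real Dk * s5dMargin w T r D o v F := by
      rw [hmain, hnext]
      have e : μ.real Dk * (cshMarg L p o v (surplus w T' r F) - surplus w T' r F k * cshMarg L p o v ck) -
            ε * μ.real Dk - ε * μ.real Dk =
          (μ.real Dk * cshMarg L p o v (surplus w T' r F) + cshMarg L p o v (covD w k (↑T' : Set (Fin n)) Fh) -
              κ * μ.real Dk * cshMarg L p o v ck) -
            (cshMarg L p o v (covD w k (↑T' : Set (Fin n)) Fh) + ε * μ.real Dk) -
            (μ.real Dk * ((surplus w T' r F k - κ) * cshMarg L p o v ck) + ε * μ.real Dk) := by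
        ring
      rw [e]
      linarith [hA, hB]
    -- divide by `μ(Dk) > 0`
    have h6' := mul_le_mul_of_nonneg_left h6 hDkpos.le
    have hcard : (T.card : ℝ) = (T'.card : ℝ) + 1 := by
      have h := Finset.card_erase_add_one hkT
      rw [← hT'] at h
      exact_mod_cast h.symm
    have hfin : μ.real Dk * (-(2 * ε * T.card)) ≤ μ.real Dk * s5dMargin w T r D o v F := by
      rw [hcard]
      have e : μ.real Dk * (-(2 * ε * ((T'.card : ℝ) + 1))) =
          μ.real Dk * (-(2 * ε * T'.card)) - ε * μ.real Dk - ε * μ.real Dk := by ring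
      rw [e]
      linarith [h6', hstep]
    exact le_of_mul_le_mul_left hfin hDkpos
  intro T r D F hF hF0 hF1 hr hcompat hoT hvT hD hDT
  exact main T.card T r D F rfl hF hF0 hF1 hr hcompat hoT hvT hD hDT

end CSH.Defect

end Summit.CriticalPhenomena.PercolationContinuityZ3.Theorems

end
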